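/-
Copyright (c) 2026 the pub-hodgecm-mathlib formalisation cell (harness21).  Prover seat hodgecm-mathlib-K2Liu-p05 (g4), 2026-09-04
(Track B «K2-LIT», crux hLiu418 = stmt-HodgeConjecture-24832, LEAD F0P6-plan (g13) RULING M-157m (1) organ (SD-1-ind), file (V-4a):
every polynomial in the entries of a `2 × 2` matrix is a finite combination of powers of trace forms `tr(Θ x)` against HERMITIAN directions `Θ`).
-/
import Summits.HodgeConjecture.HodgeConjecture.Theorems.K2LiuPolyGaussianPolarization      -- ★ (SD-1) L2: `factorial_mul_prod_eq_sum_powerset_pow`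
import Mathlib.LinearAlgebra.Finsupp.LinearCombination
import Mathlib.LinearAlgebra.Matrix.Hermitian
import HarnessLib

/-!
# (SD-1-ind, V-4a) Polynomials in the entries as combinations of powers of hermitian trace forms

Track B ∕ K2-LIT, hLiu418 = stmt-HodgeConjecture-24832; LEAD F0P6-plan (g13) RULING M-157m (1) «(L2) POLARIZATION with `X :=` the entries».
Namespace `Summit.HodgeConjecture.HodgeConjecture.Cruxes.HLiu418.K2LiuPolynomialsAsHermitianTracePowers`.  THEOREMS ONLY;
`--supports stmt-HodgeConjecture-24832 --as helper`.

`exists_finsupp_eq_sum_tracePow`: for every `P ∈ ℂ[x_{jk} : j, k ∈ Fin 2]` there is a finitely supported family of coefficients `κ_{(Θ, e)} ∈ ℂ`,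
indexed by HERMITIAN `Θ` and exponents `e ∈ ℕ`, with `P = Σ κ_{(Θ,e)} · ℓ_Θ^e`, `ℓ_Θ = Σ_{jk} Θ_{kj} x_{jk}` (so `ℓ_Θ(x) = tr(Θ x)`).
PROOF: the four entries are `ℂ`-combinations of `ℓ_Θ` for the hermitian `Θ ∈ {E₀₀, E₁₁, S, A}` (`S = E₀₁ + E₁₀`, `A = i(E₀₁ − E₁₀)`); the span `V` of
the `ℓ_Θ^e` is stable under multiplication by each `ℓ_{Θ'}` by ★ POLARIZATION `(e+1)!·ℓ_Θ^e ℓ_{Θ'} = Σ_{S ⊆ [e+1]} (−1)^{e+1−|S|} ℓ_{Θ_S}^{e+1}`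
(`Θ_S` = a sum of copies of `Θ, Θ'`, hermitian); induction on `P`.
USE ((V-4b)): with ★ (V-1) `iteratedDeriv_xiTwo_hLine` every polynomial MOMENT of a `ξ`-integrand is a finite combination of REAL `h`-line derivatives
`(d∕dt)^e ξ(1, h + tΘ; A, B)|₀` along hermitian `Θ` — hermitian directions are exactly those along which `ξ(1, ·)` is differentiable.

HONEST LABEL: HC_CM is proved only modulo the 7 printed citations (2 remaining named inputs: hLiu418 = stmt-HodgeConjecture-24832, h413 =
stmt-HodgeConjecture-24833) until rung 0 closes; organ capital, moves no counter.

## References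
[Shimura1997] G. Shimura, *Euler Products and Eisenstein Series*, CBMS 93 (1997), §16 (orientation) · polarization of multilinear forms [folklore].
-/

set_option autoImplicit false
set_option linter.dupNamespace false

noncomputable section

open scoped Matrix ComplexConjugate
open Complex Matrix Finset
open Summit.HodgeConjecture.HodgeConjecture.Cruxes.HLiu418.K2LiuPolyGaussianShiftDerivatives (factorial_mul_prod_eq_sum_powerset_pow)

namespace Summit.HodgeConjecture.HodgeConjecture.Cruxes.HLiu418.K2LiuPolynomialsAsHermitianTracePowers

/-! ## §1 The trace form `ℓ_Θ = Σ_{jk} Θ_{kj} X_{jk}` is additive in `Θ` -/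

/-- `ℓ_{Θ + Θ'} = ℓ_Θ + ℓ_{Θ'}`. [folklore] -/
theorem tracePoly_add (Θ Θ' : Matrix (Fin 2) (Fin 2) ℂ) :
    (∑ jk : Fin 2 × Fin 2, MvPolynomial.C ((Θ + Θ') jk.2 jk.1) * MvPolynomial.X jk : MvPolynomial (Fin 2 × Fin 2) ℂ) =
      (∑ jk : Fin 2 × Fin 2, MvPolynomial.C (Θ jk.2 jk.1) * MvPolynomial.X jk) + ∑ jk : Fin 2 × Fin 2, MvPolynomial.C (Θ' jk.2 jk.1) * MvPolynomial.X jk := by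
  rw [← Finset.sum_add_distrib]
  refine Finset.sum_congr rfl fun jk _ => ?_
  rw [Matrix.add_apply, map_add, add_mul]

/-- `ℓ_0 = 0`. [folklore] -/
theorem tracePoly_zero :
    (∑ jk : Fin 2 × Fin 2, MvPolynomial.C ((0 : Matrix (Fin 2) (Fin 2) ℂ) jk.2 jk.1) * MvPolynomial.X jk : MvPolynomial (Fin 2 × Fin 2) ℂ) = 0 := by
  simp

/-- `ℓ_{Σ_{j∈S} M_j} = Σ_{j∈S} ℓ_{M_j}`. [folklore] -/
theorem tracePoly_sum {ι : Type*} (S : Finset ι) (M : ι → Matrix (Fin 2) (Fin 2) ℂ) :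
    (∑ jk : Fin 2 × Fin 2, MvPolynomial.C ((∑ j ∈ S, M j) jk.2 jk.1) * MvPolynomial.X jk : MvPolynomial (Fin 2 × Fin 2) ℂ) =
      ∑ j ∈ S, ∑ jk : Fin 2 × Fin 2, MvPolynomial.C (M j jk.2 jk.1) * MvPolynomial.X jk := by
  classical
  induction S using Finset.induction_on with
  | empty => rw [Finset.sum_empty, Finset.sum_empty, tracePoly_zero]
  | insert a S ha ih => rw [Finset.sum_insert ha, Finset.sum_insert ha, tracePoly_add, ih]

/-- a finite sum of hermitian matrices is hermitian. [folklore] -/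
theorem isHermitian_sum {ι : Type*} (S : Finset ι) {M : ι → Matrix (Fin 2) (Fin 2) ℂ} (hM : ∀ j, (M j).IsHermitian) :
    (∑ j ∈ S, M j).IsHermitian := by
  classical
  induction S using Finset.induction_on with
  | empty => rw [Finset.sum_empty]; exact isHermitian_zero
  | insert a S ha ih => rw [Finset.sum_insert ha]; exact (hM a).add ih

/-! ## §2 The span of the hermitian trace powers is a subalgebra containing the coordinates -/

/-- **POLARIZATION STEP**: `ℓ_Θ^e · ℓ_{Θ'}` lies in the span of the `ℓ_{Θ''}^{e'}`, `Θ''` hermitian. [folklore] -/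
theorem tracePow_mul_tracePoly_mem {Θ Θ' : Matrix (Fin 2) (Fin 2) ℂ} (hΘ : Θ.IsHermitian) (hΘ' : Θ'.IsHermitian) (e : ℕ) :
    (∑ jk : Fin 2 × Fin 2, MvPolynomial.C (Θ jk.2 jk.1) * MvPolynomial.X jk : MvPolynomial (Fin 2 × Fin 2) ℂ) ^ e *
        (∑ jk : Fin 2 × Fin 2, MvPolynomial.C (Θ' jk.2 jk.1) * MvPolynomial.X jk) ∈
      Submodule.span ℂ (Set.range fun p : {M : Matrix (Fin 2) (Fin 2) ℂ // M.IsHermitian} × ℕ =>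
        (∑ jk : Fin 2 × Fin 2, MvPolynomial.C ((p.1 : Matrix (Fin 2) (Fin 2) ℂ) jk.2 jk.1) * MvPolynomial.X jk : MvPolynomial (Fin 2 × Fin 2) ℂ) ^ p.2) := by
  classical
  -- the letters `y = (ℓ_Θ, …, ℓ_Θ, ℓ_{Θ'})` of length `e + 1`
  set M : Fin (e + 1) → Matrix (Fin 2) (Fin 2) ℂ := Fin.snoc (fun _ : Fin e => Θ) Θ' with hM
  have hMherm : ∀ j, (M j).IsHermitian := by
    intro j
    rw [hM]
    refine Fin.lastCases ?_ (fun i => ?_) j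
    · rw [Fin.snoc_last]; exact hΘ'
    · rw [Fin.snoc_castSucc]; exact hΘ
  set ℓ : Matrix (Fin 2) (Fin 2) ℂ → MvPolynomial (Fin 2 × Fin 2) ℂ :=
    fun N => ∑ jk : Fin 2 × Fin 2, MvPolynomial.C (N jk.2 jk.1) * MvPolynomial.X jk with hℓ
  have hprod : ∏ j, ℓ (M j) = ℓ Θ ^ e * ℓ Θ' := by
    rw [Fin.prod_univ_castSucc, hM]
    simp only [Fin.snoc_castSucc, Fin.snoc_last, Finset.prod_const, Finset.card_univ, Fintype.card_fin]
  have hpol := factorial_mul_prod_eq_sum_powerset_pow (fun j => ℓ (M j))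
  rw [hprod] at hpol
  -- divide by `(e+1)!`
  have hfac : (((e + 1).factorial : ℕ) : ℂ) ≠ 0 := by exact_mod_cast (Nat.factorial_pos _).ne'
  have hrepr : ℓ Θ ^ e * ℓ Θ' =
      ((((e + 1).factorial : ℕ) : ℂ)⁻¹) • ∑ S : Finset (Fin (e + 1)), (-1 : MvPolynomial (Fin 2 × Fin 2) ℂ) ^ (e + 1 - #S) * (∑ j ∈ S, ℓ (M j)) ^ (e + 1) := by
    rw [← hpol, MvPolynomial.smul_eq_C_mul, ← mul_assoc, ← map_natCast (MvPolynomial.C (σ := Fin 2 × Fin 2) (R := ℂ)), ← map_mul,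
      inv_mul_cancel₀ hfac, map_one, one_mul]
  change ℓ Θ ^ e * ℓ Θ' ∈ _
  rw [hrepr]
  refine Submodule.smul_mem _ _ (Submodule.sum_mem _ fun S _ => ?_)
  rw [show ((-1 : MvPolynomial (Fin 2 × Fin 2) ℂ) ^ (e + 1 - #S)) = MvPolynomial.C ((-1 : ℂ) ^ (e + 1 - #S)) by rw [map_pow, map_neg, map_one],
    ← MvPolynomial.smul_eq_C_mul]
  refine Submodule.smul_mem _ _ (Submodule.subset_span ⟨(⟨∑ j ∈ S, M j, isHermitian_sum S hMherm⟩, e + 1), ?_⟩)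
  change ℓ (∑ j ∈ S, M j) ^ (e + 1) = (∑ j ∈ S, ℓ (M j)) ^ (e + 1)
  simp only [hℓ, tracePoly_sum]

/-- the span is stable under multiplication by `ℓ_{Θ'}`, `Θ'` hermitian. [folklore] -/
theorem mul_tracePoly_mem {p : MvPolynomial (Fin 2 × Fin 2) ℂ}
    (hp : p ∈ Submodule.span ℂ (Set.range fun p : {M : Matrix (Fin 2) (Fin 2) ℂ // M.IsHermitian} × ℕ =>
        (∑ jk : Fin 2 × Fin 2, MvPolynomial.C ((p.1 : Matrix (Fin 2) (Fin 2) ℂ) jk.2 jk.1) * MvPolynomial.X jk : MvPolynomial (Fin 2 × Fin 2) ℂ) ^ p.2))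
    {Θ' : Matrix (Fin 2) (Fin 2) ℂ} (hΘ' : Θ'.IsHermitian) :
    p * (∑ jk : Fin 2 × Fin 2, MvPolynomial.C (Θ' jk.2 jk.1) * MvPolynomial.X jk) ∈
      Submodule.span ℂ (Set.range fun p : {M : Matrix (Fin 2) (Fin 2) ℂ // M.IsHermitian} × ℕ =>
        (∑ jk : Fin 2 × Fin 2, MvPolynomial.C ((p.1 : Matrix (Fin 2) (Fin 2) ℂ) jk.2 jk.1) * MvPolynomial.X jk : MvPolynomial (Fin 2 × Fin 2) ℂ) ^ p.2) := by
  induction hp using Submodule.span_induction with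
  | mem x hx =>
    obtain ⟨⟨⟨Θ, hΘ⟩, e⟩, rfl⟩ := hx
    exact tracePow_mul_tracePoly_mem hΘ hΘ' e
  | zero => rw [zero_mul]; exact Submodule.zero_mem _
  | add x y _ _ hx hy => rw [add_mul]; exact Submodule.add_mem _ hx hy
  | smul a x _ hx => rw [smul_mul_assoc]; exact Submodule.smul_mem _ a hx

/-- **the coordinates are combinations of hermitian trace forms**: `X_{jk} = Σ_r c_r ℓ_{B_r}` with `B_r ∈ {E₀₀, E₁₁, S, A}` hermitian —
recorded as: `p · X_{jk}` stays in the span. [folklore] -/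
theorem mul_X_mem {p : MvPolynomial (Fin 2 × Fin 2) ℂ}
    (hp : p ∈ Submodule.span ℂ (Set.range fun p : {M : Matrix (Fin 2) (Fin 2) ℂ // M.IsHermitian} × ℕ =>
        (∑ jk : Fin 2 × Fin 2, MvPolynomial.C ((p.1 : Matrix (Fin 2) (Fin 2) ℂ) jk.2 jk.1) * MvPolynomial.X jk : MvPolynomial (Fin 2 × Fin 2) ℂ) ^ p.2))
    (v : Fin 2 × Fin 2) :
    p * MvPolynomial.X v ∈
      Submodule.span ℂ (Set.range fun p : {M : Matrix (Fin 2) (Fin 2) ℂ // M.IsHermitian} × ℕ =>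
        (∑ jk : Fin 2 × Fin 2, MvPolynomial.C ((p.1 : Matrix (Fin 2) (Fin 2) ℂ) jk.2 jk.1) * MvPolynomial.X jk : MvPolynomial (Fin 2 × Fin 2) ℂ) ^ p.2) := by
  -- the four hermitian directions
  have hE00 : (!![1, 0; 0, 0] : Matrix (Fin 2) (Fin 2) ℂ).IsHermitian := by
    rw [Matrix.IsHermitian]; ext i j; fin_cases i <;> fin_cases j <;> simp
  have hE11 : (!![0, 0; 0, 1] : Matrix (Fin 2) (Fin 2) ℂ).IsHermitian := by
    rw [Matrix.IsHermitian]; ext i j; fin_cases i <;> fin_cases j <;> simp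
  have hS : (!![0, 1; 1, 0] : Matrix (Fin 2) (Fin 2) ℂ).IsHermitian := by
    rw [Matrix.IsHermitian]; ext i j; fin_cases i <;> fin_cases j <;> simp
  have hA : (!![0, I; -I, 0] : Matrix (Fin 2) (Fin 2) ℂ).IsHermitian := by
    rw [Matrix.IsHermitian]; ext i j; fin_cases i <;> fin_cases j <;> simp
  -- the trace forms of the four directions
  have l00 : (∑ jk : Fin 2 × Fin 2, MvPolynomial.C ((!![1, 0; 0, 0] : Matrix (Fin 2) (Fin 2) ℂ) jk.2 jk.1) * MvPolynomial.X jk :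
      MvPolynomial (Fin 2 × Fin 2) ℂ) = MvPolynomial.X (0, 0) := by
    simp [Fintype.sum_prod_type, Fin.sum_univ_two]
  have l11 : (∑ jk : Fin 2 × Fin 2, MvPolynomial.C ((!![0, 0; 0, 1] : Matrix (Fin 2) (Fin 2) ℂ) jk.2 jk.1) * MvPolynomial.X jk :
      MvPolynomial (Fin 2 × Fin 2) ℂ) = MvPolynomial.X (1, 1) := by
    simp [Fintype.sum_prod_type, Fin.sum_univ_two]
  have lS : (∑ jk : Fin 2 × Fin 2, MvPolynomial.C ((!![0, 1; 1, 0] : Matrix (Fin 2) (Fin 2) ℂ) jk.2 jk.1) * MvPolynomial.X jk :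
      MvPolynomial (Fin 2 × Fin 2) ℂ) = MvPolynomial.X (0, 1) + MvPolynomial.X (1, 0) := by
    simp [Fintype.sum_prod_type, Fin.sum_univ_two]
  have lA : (∑ jk : Fin 2 × Fin 2, MvPolynomial.C ((!![0, I; -I, 0] : Matrix (Fin 2) (Fin 2) ℂ) jk.2 jk.1) * MvPolynomial.X jk :
      MvPolynomial (Fin 2 × Fin 2) ℂ) = MvPolynomial.C (-I) * MvPolynomial.X (0, 1) + MvPolynomial.C I * MvPolynomial.X (1, 0) := by
    simp [Fintype.sum_prod_type, Fin.sum_univ_two]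
  have m00 := mul_tracePoly_mem hp hE00
  have m11 := mul_tracePoly_mem hp hE11
  have mS := mul_tracePoly_mem hp hS
  have mA := mul_tracePoly_mem hp hA
  rw [l00] at m00
  rw [l11] at m11
  rw [lS] at mS
  rw [lA] at mA
  rcases v with ⟨j, k⟩
  fin_cases j <;> fin_cases k
  · exact m00
  · -- `2·X₀₁ = ℓ_S + i ℓ_A`
    have hII : (MvPolynomial.C I : MvPolynomial (Fin 2 × Fin 2) ℂ) * MvPolynomial.C I = -1 := by
      rw [← map_mul, I_mul_I, map_neg, map_one]
    have h01 : (2 : ℂ) • (p * MvPolynomial.X ((0 : Fin 2), (1 : Fin 2))) =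
        p * (MvPolynomial.X (0, 1) + MvPolynomial.X (1, 0)) + I • (p * (MvPolynomial.C (-I) * MvPolynomial.X (0, 1) + MvPolynomial.C I * MvPolynomial.X (1, 0))) := by
      rw [MvPolynomial.smul_eq_C_mul, MvPolynomial.smul_eq_C_mul, map_ofNat, map_neg]
      linear_combination (p * MvPolynomial.X (0, 1) - p * MvPolynomial.X (1, 0)) * hII
    have hmem := Submodule.add_mem _ mS (Submodule.smul_mem _ I mA)
    rw [← h01] at hmem
    simpa only [Fin.zero_eta, Fin.mk_one, inv_smul_smul₀ (two_ne_zero' ℂ)] using Submodule.smul_mem _ (2 : ℂ)⁻¹ hmem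
  · -- `2·X₁₀ = ℓ_S − i ℓ_A`
    have hII : (MvPolynomial.C I : MvPolynomial (Fin 2 × Fin 2) ℂ) * MvPolynomial.C I = -1 := by
      rw [← map_mul, I_mul_I, map_neg, map_one]
    have h10 : (2 : ℂ) • (p * MvPolynomial.X ((1 : Fin 2), (0 : Fin 2))) =
        p * (MvPolynomial.X (0, 1) + MvPolynomial.X (1, 0)) - I • (p * (MvPolynomial.C (-I) * MvPolynomial.X (0, 1) + MvPolynomial.C I * MvPolynomial.X (1, 0))) := by
      rw [MvPolynomial.smul_eq_C_mul, MvPolynomial.smul_eq_C_mul, map_ofNat, map_neg]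
      linear_combination (p * MvPolynomial.X (1, 0) - p * MvPolynomial.X (0, 1)) * hII
    have hmem := Submodule.sub_mem _ mS (Submodule.smul_mem _ I mA)
    rw [← h10] at hmem
    simpa only [Fin.zero_eta, Fin.mk_one, inv_smul_smul₀ (two_ne_zero' ℂ)] using Submodule.smul_mem _ (2 : ℂ)⁻¹ hmem
  · exact m11

/-- **every polynomial lies in the span of the hermitian trace powers**. [folklore] -/
theorem mem_span_tracePow (P : MvPolynomial (Fin 2 × Fin 2) ℂ) :
    P ∈ Submodule.span ℂ (Set.range fun p : {M : Matrix (Fin 2) (Fin 2) ℂ // M.IsHermitian} × ℕ =>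
        (∑ jk : Fin 2 × Fin 2, MvPolynomial.C ((p.1 : Matrix (Fin 2) (Fin 2) ℂ) jk.2 jk.1) * MvPolynomial.X jk : MvPolynomial (Fin 2 × Fin 2) ℂ) ^ p.2) := by
  induction P using MvPolynomial.induction_on with
  | C a =>
    -- `C a = a • ℓ_0^0`
    have h1 : (MvPolynomial.C a : MvPolynomial (Fin 2 × Fin 2) ℂ) =
        a • (∑ jk : Fin 2 × Fin 2, MvPolynomial.C ((0 : Matrix (Fin 2) (Fin 2) ℂ) jk.2 jk.1) * MvPolynomial.X jk : MvPolynomial (Fin 2 × Fin 2) ℂ) ^ 0 := by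
      rw [pow_zero, MvPolynomial.smul_eq_C_mul, mul_one]
    rw [h1]
    exact Submodule.smul_mem _ _ (Submodule.subset_span ⟨(⟨0, isHermitian_zero⟩, 0), rfl⟩)
  | add p q hp hq => exact Submodule.add_mem _ hp hq
  | mul_X p v hp => exact mul_X_mem hp v

/-! ## §3 The finite representation -/

/-- **EVERY POLYNOMIAL IN THE ENTRIES IS A FINITE COMBINATION OF POWERS OF HERMITIAN TRACE FORMS**:
`P = Σ_{(Θ, e)} κ_{(Θ,e)} · (Σ_{jk} Θ_{kj} X_{jk})^e` with finitely many nonzero `κ`, all `Θ` hermitian. [folklore] -/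
theorem exists_finsupp_eq_sum_tracePow (P : MvPolynomial (Fin 2 × Fin 2) ℂ) :
    ∃ κ : ({M : Matrix (Fin 2) (Fin 2) ℂ // M.IsHermitian} × ℕ) →₀ ℂ,
      (κ.sum fun p a => a • (∑ jk : Fin 2 × Fin 2, MvPolynomial.C ((p.1 : Matrix (Fin 2) (Fin 2) ℂ) jk.2 jk.1) * MvPolynomial.X jk :
        MvPolynomial (Fin 2 × Fin 2) ℂ) ^ p.2) = P :=
  Finsupp.mem_span_range_iff_exists_finsupp.1 (mem_span_tracePow P)

end Summit.HodgeConjecture.HodgeConjecture.Cruxes.HLiu418.K2LiuPolynomialsAsHermitianTracePowers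

end
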